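import Summits.BirchSwinnertonDyer.BirchSwinnertonDyer.Theses.SignedBaseChange
import Summits.BirchSwinnertonDyer.BirchSwinnertonDyer.Theorems.SignedBaseChangeK2RAssembly
import HarnessLib

/-!
# K2R⁗ `SignedLowerDescentFromTwoVariablePackage` holds (route `SignedBaseChange`, rev 14″)

Closer of the crux item stmt-BirchSwinnertonDyer-20521 of the cell `bsd-wall` route
`route-BirchSwinnertonDyer-SignedBaseChange` (seat `bsd-wall-sbc-p2` g4; statement born at route rev 15/16 by the
tenure planner's rev-14″ apply, superseding K2R‴ stmt-BirchSwinnertonDyer-20213).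

K2R⁗ is stated BY NAME over the route decls `SignedTwoVariableInputs` (= BCS25 Prop. 4.2.2 `L_p^Gr`-half `μ = 0`
∧ the BSTW two-variable signed package binder) and K1″ `TwistPairGreenbergProductDivisibilityCanonical`
(= `SignedTwoVariableInputs →` modularity `→` the canonical twist-pair Greenberg product package). Its content was
assembled and landed by seat g2 as
`SignedBaseChangeK2RAssembly.signedLowerDescent_of_prop422_of_package` (p533062): the only difference between that
theorem's `∃`-package and K1″'s is the position of the clause «`γ₁` canonical up to torsion» (K1″: right after
`κ₁.IsCyclotomic ∧ κ₂.IsAnticyclotomic`; p533062: last conjunct). The proof below feeds K1″ its two antecedents,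
destructures its package, reorders that one clause and applies p533062 (this is planner ss g5's certified glue
rev14/Sketch15, re-certified by g3 as `post-freeze/K2R4ClosureTest_rev14b_rc0.lean`).

Honesty note: the two published inputs and K1″ stay HYPOTHESES of K2R⁗ (they are route items of their own:
stmt-BirchSwinnertonDyer-20515, stmt-BirchSwinnertonDyer-20519); nothing is asserted about them here.
-/

set_option autoImplicit false
-- justification: the layout's summit-side namespace for a single-conjunct summit (Sub = Summit) repeats the
-- component `BirchSwinnertonDyer`; the closer must live at `Summit.<S>.<Sub>.Theorems.<decl>_proof`.
set_option linter.dupNamespace false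

namespace Summit.BirchSwinnertonDyer.BirchSwinnertonDyer.Theorems

open Summit.BirchSwinnertonDyer.BirchSwinnertonDyer.Theses.SignedBaseChange

/-- **K2R⁗ `SignedLowerDescentFromTwoVariablePackage` holds.** From Kobayashi Thm. 4.1 / Thm. 1.2 (named facts),
modularity and the period-unit fact (route aliases `ModularParametrizationSupply`, `RealPeriodUnitPlusPeriod`), the
BSTW common-frame binder `GreenbergSupersingularFrameInput`, the two by-name signed inputs `SignedTwoVariableInputs`
and the canonical twist-pair Greenberg product package K1″ `TwistPairGreenbergProductDivisibilityCanonical`, every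
globally minimal `W/ℚ` in class X7 with surjective mod-`p` image at a supersingular prime `p ≥ 5` satisfies the
Eisenstein half `KobayashiLowerDivisibility W p ε` for both signs `ε`. Proof: instantiate K1″ at the inputs and
at modularity, move its clause «`γ₁` canonical» to the end of the `∃`-package, and apply
`SignedBaseChangeK2RAssembly.signedLowerDescent_of_prop422_of_package` (p533062).
[cite: BurungaleSkinnerTianWan2024, Part III §2.3 proof of Thm. (KoMC_r) with Props. 1.18, 2.7, 5.19 (arXiv:2409.01350v2; PREPRINT, by name)]
[cite: BurungaleCastellaSkinner2025, Prop. 4.2.2 (§4.2, p. 9 of arXiv:2405.00270v2; by name)]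
[cite: Kobayashi2003, Thm. 4.1 and Thm. 1.2 (by name)] -/
theorem signedLowerDescentFromTwoVariablePackage_proof :
    Summit.BirchSwinnertonDyer.BirchSwinnertonDyer.Theses.SignedBaseChange.SignedLowerDescentFromTwoVariablePackage := by
  unfold SignedLowerDescentFromTwoVariablePackage
  intro h41 h12 hmodP h5 hGF hIn h₁ W _ _ p _ hp5 hX hs ε
  obtain ⟨K, iF, iNF, ι, v, vbar, κ₁, κ₂, γ₁, γ₂, iTG, iNZ, N, iN, f, d, W', iE', iM', C, N', iN', f',
    c1, c2, c3, c4, c5, c6, c7, c8, c9, c10, c11, c12, c13, c14, c15, c16, c17, c18, c19, c20, c21, hcan, c22⟩ :=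
    h₁ hIn hmodP W p hp5 hX hs
  exact SignedBaseChangeK2RAssembly.signedLowerDescent_of_prop422_of_package hIn.1 hIn.2 h41 h12 hmodP h5 hGF
    W p hp5 hX hs
    ⟨K, iF, iNF, ι, v, vbar, κ₁, κ₂, γ₁, γ₂, iTG, iNZ, N, iN, f, d, W', iE', iM', C, N', iN', f',
      c1, c2, c3, c4, c5, c6, c7, c8, c9, c10, c11, c12, c13, c14, c15, c16, c17, c18, c19, c20, c21, c22, hcan⟩ ε

end Summit.BirchSwinnertonDyer.BirchSwinnertonDyer.Theorems
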